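import Mathlib
import Literature.Analysis.FluidPDE.NSWave0
import HarnessLib

/-!
# Slice bounds for a Clay-class force: `f(t) ∈ L² ∩ Ḣ¹` uniformly in `t ≥ 0`

HONEST FRAMING (cell `ns-blowup`, seat `ns-blowup-ecbridge-2` g0, human ruling D-0035): plumbing for
the `E–C` endpoint audit; nothing here is a statement about Navier–Stokes. WHAT THIS IS NOT: not NS.

Fefferman's force class (C) (tree: `IsSmoothOnHalfSpace f` = `C^∞` on `[0,∞) × ℝ³` as a function of
`(t, x)`, and `HasRapidSpaceTimeDecay f` = `(1 + |x| + t)^K ‖D^n_{(t,x)} f‖ ≤ C_{n,K}`) is stated for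
the SPACE–TIME function. The kernel theorems of the audit consume SLICE data: the forced Serrin
enstrophy bound `Literature.Analysis.FluidPDE.enstrophy_le_of_serrin_forced_uniform` and
`SerrinDivergenceMaximalForced.lintegral_serrin_eq_top_of_isMaximalSmoothSolution` ask, slab by slab,
for `∫ |f(t)|² ≤ C`, `∫ |D(f(t))|² ≤ C` and a measurable majorant `F(t) ≥ ‖f(t)‖²_{L²}` with
`∫₀ᵀ F < ∞`. This file supplies them from the Clay class once and for all:

* `norm_slice_le_of_hasRapidSpaceTimeDecay` — `‖f t x‖ ≤ C / (1 + ‖x‖)^K` for `t ≥ 0` (case `n = 0`);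
* `hasFDerivAt_slice_of_isSmoothOnHalfSpace` / `norm_fderiv_slice_le` — for `t ≥ 0` the slice `f t`
  is differentiable and `‖D(f t)(x)‖ ≤ ‖D_{(t,x)}(uncurry f)‖` (chain rule with `x ↦ (t, x)`, whose
  derivative `inr` has norm `≤ 1`), hence `‖D(f t)(x)‖ ≤ C / (1 + ‖x‖)^K` (case `n = 1`);
* `lintegral_enorm_sq_le_of_norm_le_inv_sq` — on `ℝ³`, `‖g x‖ ≤ C/(1+‖x‖)²` gives
  `∫⁻ ‖g‖ₑ² ≤ C² ∫ (1+‖x‖)^{-4} < ∞` (Mathlib `finite_integral_one_add_norm`, `4 > 3`);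
* `clayForce_slice_bounds` — THE PACKAGE: uniform-in-`t ≥ 0` bounds `∫⁻ ‖f t‖ₑ² ≤ C₀`,
  `∫⁻ ‖iteratedFDeriv ℝ 1 (f t)‖ₑ² ≤ C₁` with `C₀, C₁ : ℝ≥0`; so `F := C₀` (a constant, measurable,
  `∫₀ᵀ F = T·C₀ < ∞`) is an admissible majorant and the `n ≤ 1` slice hypotheses of the Serrin files
  hold on every slab.
-/

noncomputable section

namespace Summit.NavierStokesRegularity.FluidComputer.ClayForceSliceBounds

open Set MeasureTheory Function Literature.Analysis.FluidPDE
open scoped ENNReal NNReal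

variable {E : Type*} [NormedAddCommGroup E] [InnerProductSpace ℝ E]
variable {F : Type*} [NormedAddCommGroup F] [NormedSpace ℝ F]

/-- Pointwise decay of the slices from Fefferman's (5) with `n = 0`: `‖f t x‖ ≤ C / (1 + ‖x‖)^K` for
all `t ≥ 0`, `x` (drop the `t` in `1 + ‖x‖ + t`). -/
theorem norm_slice_le_of_hasRapidSpaceTimeDecay {f : ℝ → E → F} (hd : HasRapidSpaceTimeDecay f)
    (K : ℕ) : ∃ C : ℝ, 0 ≤ C ∧ ∀ t, 0 ≤ t → ∀ x, ‖f t x‖ ≤ C / (1 + ‖x‖) ^ K := by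
  obtain ⟨C, hC⟩ := hd 0 K
  have hC0 : 0 ≤ C := by
    have h := hC 0 le_rfl 0
    exact le_trans (mul_nonneg (pow_nonneg (by positivity) K) (norm_nonneg _)) h
  refine ⟨C, hC0, fun t ht x => ?_⟩
  have h := hC t ht x
  rw [norm_iteratedFDerivWithin_zero] at h
  have hpos : 0 < (1 + ‖x‖) ^ K := pow_pos (by positivity) K
  rw [le_div_iff₀ hpos, mul_comm]
  calc (1 + ‖x‖) ^ K * ‖uncurry f (t, x)‖ ≤ (1 + ‖x‖ + t) ^ K * ‖uncurry f (t, x)‖ :=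
        mul_le_mul_of_nonneg_right (pow_le_pow_left₀ (by positivity) (by linarith) K)
          (norm_nonneg _)
    _ ≤ C := h

/-- For `t ≥ 0` the slice `f t` of a field smooth on the closed half-space `[0,∞) × E` is
differentiable, with derivative the space–time derivative within the half-space composed with
`x ↦ (t, x)` (`inr`). -/
theorem hasFDerivAt_slice_of_isSmoothOnHalfSpace {f : ℝ → E → F} (hs : IsSmoothOnHalfSpace f)
    {t : ℝ} (ht : 0 ≤ t) (x : E) :
    HasFDerivAt (f t)
      ((fderivWithin ℝ (uncurry f) (Ici (0 : ℝ) ×ˢ univ) (t, x)).comp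
        (ContinuousLinearMap.inr ℝ ℝ E)) x := by
  have hmem : (t, x) ∈ Ici (0 : ℝ) ×ˢ (univ : Set E) := mk_mem_prod ht (mem_univ x)
  have hdiff : DifferentiableWithinAt ℝ (uncurry f) (Ici (0 : ℝ) ×ˢ univ) (t, x) :=
    (hs (t, x) hmem).differentiableWithinAt (by simp)
  have hG := hdiff.hasFDerivWithinAt
  have hι : HasFDerivWithinAt (fun y : E => ((t, y) : ℝ × E)) (ContinuousLinearMap.inr ℝ ℝ E)
      univ x := (hasFDerivAt_prodMk_right t x).hasFDerivWithinAt
  have hmaps : MapsTo (fun y : E => ((t, y) : ℝ × E)) univ (Ici (0 : ℝ) ×ˢ univ) :=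
    fun y _ => mk_mem_prod ht (mem_univ y)
  have hcomp := hG.comp x hι hmaps
  have heq : (uncurry f) ∘ (fun y : E => ((t, y) : ℝ × E)) = f t := by
    funext y; rfl
  rw [heq] at hcomp
  exact hcomp.hasFDerivAt_of_univ

/-- `‖D(f t)(x)‖ ≤ ‖D¹_{(t,x)} (uncurry f)‖` (the first space–time derivative within the half-space)
for `t ≥ 0`. -/
theorem norm_fderiv_slice_le {f : ℝ → E → F} (hs : IsSmoothOnHalfSpace f) {t : ℝ} (ht : 0 ≤ t)
    (x : E) :
    ‖fderiv ℝ (f t) x‖ ≤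
      ‖iteratedFDerivWithin ℝ 1 (uncurry f) (Ici (0 : ℝ) ×ˢ univ) (t, x)‖ := by
  have hmem : (t, x) ∈ Ici (0 : ℝ) ×ˢ (univ : Set E) := mk_mem_prod ht (mem_univ x)
  have hU : UniqueDiffWithinAt ℝ (Ici (0 : ℝ) ×ˢ (univ : Set E)) (t, x) :=
    ((uniqueDiffOn_Ici 0).prod uniqueDiffOn_univ) (t, x) hmem
  rw [norm_iteratedFDerivWithin_one _ hU, (hasFDerivAt_slice_of_isSmoothOnHalfSpace hs ht x).fderiv]
  refine ContinuousLinearMap.opNorm_le_bound _ (norm_nonneg _) fun v => ?_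
  rw [ContinuousLinearMap.comp_apply]
  refine (ContinuousLinearMap.le_opNorm _ _).trans (mul_le_mul_of_nonneg_left ?_ (norm_nonneg _))
  rw [ContinuousLinearMap.inr_apply, Prod.norm_def]
  simp

/-- Pointwise decay of the slice DERIVATIVES from Fefferman's (5) with `n = 1` and (6):
`‖D(f t)(x)‖ ≤ C / (1 + ‖x‖)^K` for `t ≥ 0`. -/
theorem norm_fderiv_slice_le_of_clay {f : ℝ → E → F} (hs : IsSmoothOnHalfSpace f)
    (hd : HasRapidSpaceTimeDecay f) (K : ℕ) :
    ∃ C : ℝ, 0 ≤ C ∧ ∀ t, 0 ≤ t → ∀ x, ‖fderiv ℝ (f t) x‖ ≤ C / (1 + ‖x‖) ^ K := by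
  obtain ⟨C, hC⟩ := hd 1 K
  have hC0 : 0 ≤ C := by
    have h := hC 0 le_rfl 0
    exact le_trans (mul_nonneg (pow_nonneg (by positivity) K) (norm_nonneg _)) h
  refine ⟨C, hC0, fun t ht x => ?_⟩
  have h := hC t ht x
  have hpos : 0 < (1 + ‖x‖) ^ K := pow_pos (by positivity) K
  rw [le_div_iff₀ hpos, mul_comm]
  calc (1 + ‖x‖) ^ K * ‖fderiv ℝ (f t) x‖
      ≤ (1 + ‖x‖ + t) ^ K * ‖iteratedFDerivWithin ℝ 1 (uncurry f) (Ici (0 : ℝ) ×ˢ univ) (t, x)‖ :=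
        mul_le_mul (pow_le_pow_left₀ (by positivity) (by linarith) K)
          (norm_fderiv_slice_le hs ht x) (norm_nonneg _) (by positivity)
    _ ≤ C := h

/-- On `ℝ³`: a field dominated by `C / (1 + ‖x‖)²` is square integrable, quantitatively:
`∫⁻ ‖g‖ₑ² ≤ ofReal (C² ∫ (1 + ‖x‖)^{-4}) < ∞` (`4 > 3 = dim`). -/
theorem lintegral_enorm_sq_le_of_norm_le_inv_sq {G : Type*} [NormedAddCommGroup G]
    {g : EuclideanSpace ℝ (Fin 3) → G} {C : ℝ} (hC : 0 ≤ C)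
    (hg : ∀ x, ‖g x‖ ≤ C / (1 + ‖x‖) ^ 2) :
    ∫⁻ x, ‖g x‖ₑ ^ 2 ≤
      ENNReal.ofReal (C ^ 2) * ∫⁻ x : EuclideanSpace ℝ (Fin 3), ENNReal.ofReal ((1 + ‖x‖) ^ (-(4 : ℝ))) ∧
    ∫⁻ x : EuclideanSpace ℝ (Fin 3), ENNReal.ofReal ((1 + ‖x‖) ^ (-(4 : ℝ))) < ⊤ := by
  refine ⟨?_, finite_integral_one_add_norm (by rw [finrank_euclideanSpace_fin]; norm_num)⟩
  rw [← lintegral_const_mul' _ _ ENNReal.ofReal_ne_top]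
  refine lintegral_mono fun x => ?_
  have h1 : 0 < 1 + ‖x‖ := by positivity
  have hle : ‖g x‖ ^ 2 ≤ C ^ 2 * (1 + ‖x‖) ^ (-(4 : ℝ)) := by
    have h := hg x
    have hnn : 0 ≤ C / (1 + ‖x‖) ^ 2 := by positivity
    calc ‖g x‖ ^ 2 ≤ (C / (1 + ‖x‖) ^ 2) ^ 2 := pow_le_pow_left₀ (norm_nonneg _) h 2
      _ = C ^ 2 * (1 + ‖x‖) ^ (-(4 : ℝ)) := by
          rw [Real.rpow_neg h1.le, show (4 : ℝ) = ((4 : ℕ) : ℝ) by norm_num, Real.rpow_natCast]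
          field_simp
  calc ‖g x‖ₑ ^ 2 = ENNReal.ofReal (‖g x‖ ^ 2) := by
        rw [← ofReal_norm, ENNReal.ofReal_pow (norm_nonneg _)]
    _ ≤ ENNReal.ofReal (C ^ 2 * (1 + ‖x‖) ^ (-(4 : ℝ))) := ENNReal.ofReal_le_ofReal hle
    _ = ENNReal.ofReal (C ^ 2) * ENNReal.ofReal ((1 + ‖x‖) ^ (-(4 : ℝ))) :=
        ENNReal.ofReal_mul (sq_nonneg _)

/-- **THE PACKAGE: uniform `L²` bounds of the slices of a Clay-class force and of their first
derivatives.** For `f` smooth on `[0,∞) × ℝ³` with Fefferman's space–time decay there are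
`C₀, C₁ : ℝ≥0` with `∫⁻ ‖f t‖ₑ² ≤ C₀` and `∫⁻ ‖iteratedFDeriv ℝ 1 (f t)‖ₑ² ≤ C₁` for every `t ≥ 0`.
Consequently the slice hypotheses (`n ≤ 1`) of `serrin_enstrophy_le_mul_exp_forced` /
`enstrophy_le_of_serrin_forced_uniform` / `lintegral_serrin_eq_top_of_isMaximalSmoothSolution` hold
on every slab `[0, T']`, and the constant `F := C₀` is a measurable majorant of `‖f(t)‖²_{L²}` with
`∫₀ᵀ F = T · C₀ < ∞`. -/
theorem clayForce_slice_bounds {f : ℝ → EuclideanSpace ℝ (Fin 3) → EuclideanSpace ℝ (Fin 3)}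
    (hs : IsSmoothOnHalfSpace f) (hd : HasRapidSpaceTimeDecay f) :
    (∃ C₀ : ℝ≥0, ∀ t, 0 ≤ t → ∫⁻ x, ‖f t x‖ₑ ^ 2 ≤ C₀) ∧
    (∃ C₁ : ℝ≥0, ∀ t, 0 ≤ t → ∫⁻ x, ‖iteratedFDeriv ℝ 1 (f t) x‖ₑ ^ 2 ≤ C₁) := by
  set J : ℝ≥0∞ := ∫⁻ x : EuclideanSpace ℝ (Fin 3), ENNReal.ofReal ((1 + ‖x‖) ^ (-(4 : ℝ))) with hJ
  constructor
  · obtain ⟨C, hC0, hC⟩ := norm_slice_le_of_hasRapidSpaceTimeDecay hd 2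
    have key : ∀ t, 0 ≤ t → ∫⁻ x, ‖f t x‖ₑ ^ 2 ≤ ENNReal.ofReal (C ^ 2) * J ∧ J < ⊤ :=
      fun t ht => lintegral_enorm_sq_le_of_norm_le_inv_sq hC0 (hC t ht)
    have hJtop : J < ⊤ := (key 0 le_rfl).2
    refine ⟨(ENNReal.ofReal (C ^ 2) * J).toNNReal, fun t ht => ?_⟩
    rw [ENNReal.coe_toNNReal (ENNReal.mul_ne_top ENNReal.ofReal_ne_top hJtop.ne)]
    exact (key t ht).1
  · obtain ⟨C, hC0, hC⟩ := norm_fderiv_slice_le_of_clay hs hd 2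
    have key : ∀ t, 0 ≤ t →
        ∫⁻ x, ‖iteratedFDeriv ℝ 1 (f t) x‖ₑ ^ 2 ≤ ENNReal.ofReal (C ^ 2) * J ∧ J < ⊤ := by
      intro t ht
      refine lintegral_enorm_sq_le_of_norm_le_inv_sq hC0 fun x => ?_
      rw [norm_iteratedFDeriv_one]
      exact hC t ht x
    have hJtop : J < ⊤ := (key 0 le_rfl).2
    refine ⟨(ENNReal.ofReal (C ^ 2) * J).toNNReal, fun t ht => ?_⟩
    rw [ENNReal.coe_toNNReal (ENNReal.mul_ne_top ENNReal.ofReal_ne_top hJtop.ne)]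
    exact (key t ht).1

end Summit.NavierStokesRegularity.FluidComputer.ClayForceSliceBounds

end
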